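import Summits.QuantumFields.YangMills.Theorems.UnitScaleTiltFluctuationComparisonRegPrGlobalSlackLegCfgDistNaturalT3
import Literature.MathematicalPhysics.QuantumFieldTheory.Balaban1983to89.B12Membership313IISL
import HarnessLib

/-!
# `UnitScaleTiltFluctuationComparisonRegPrGlobalSlackLegCfgDistNaturalT3Lie` — ON PRINT'S REGIME THE NATURAL FAMILY `B♮` IS PRINT'S LOOP VARIABLE EXACTLY: `(1/i) log` of an `SU(N)`
# holonomy near `1` is TRACE-FREE, trace-free matrices vectorise INTO `𝔤ᶜ = lieC (suGroupModel N)`, so the `𝔤ᶜ`-projection in `B♮` is the identity (crux `FluctuationComparisonRegPrIntL`,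
# stmt-QuantumFields-20520, skeletons v5kC / v5kD, STUB 3⁗χ; cell `pub/ym-inputs`, seat ym-inputs-p11; count-neutral helper, def-free, registry untouched)

WHY.  `…LegCfgDistNaturalT3` writes the old-level configuration as `P_{𝔤ᶜ}(vecE((1/i) log Ū^b(U_k)(Γ_{y,c₋} ∪ c ∪ Γ_{c₊,y})))` with `P_{𝔤ᶜ}` the orthogonal projection onto `lieC (suGroupModel 2)`,
so that the (44) bound needs no membership lemma.  Print's `B_k(c)` ((43) p.266) is the logarithm ITSELF, «with values in 𝔤ᶜ» ((27)–(29) p.263).  The two agree: for `W ∈ SU(N)` with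
`‖W − 1‖ ≤ ½` the series logarithm has `e^{tr log W} = det W = 1` (`B12Membership313IISL.trace_mlog_mem_zmultiples`: `tr log W ∈ 2πiℤ`) and `|tr log W| ≤ N‖log W‖ ≤ 2N‖W − 1‖ < 2π`
(`MatrixNorms.norm_ntr_le_opNorm`, `MatrixLog.norm_mlog_le_two_mul`; `N‖W−1‖ < π`), hence `tr log W = 0`; and a trace-free complex matrix is `A + (−i)(iS)` with `A = ½(X − Xᴴ)`,
`iS = ½i(X + Xᴴ)` both in `𝔰𝔲(N)` (skew-Hermitian, trace-free), i.e. lies in `span_ℂ 𝔰𝔲(N)`, whose vectorisation is `lieC`.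

* §1 `eq_zero_of_mem_zmultiples_of_norm_lt`, `norm_trace_le_card_mul_opNorm`, **`trace_mlog_eq_zero`** (`det W = 1`, `‖W − 1‖ ≤ ½`, `N·‖W − 1‖ < π`);
* §2 **`vecE_mem_lieC_of_trace_eq_zero`** (`tr X = 0 ⟹ vecE X ∈ lieC (suGroupModel N)`), `proj_vecE_eq_of_trace_eq_zero` (then `P_{𝔤ᶜ}(vecE X) = vecE X`);
* §3 **`trace_B27T_eq_zero`** — the (27)-loop variable of an `SU(N)`-valued torus field under `PlaqSmall α U` is trace-free on every bond with `|c₋ − y|₁·α ≤ ½` and `N·|c₋ − y|₁·α < π`;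
  **`coe_natural_eq_vecE_B27T`** — at the χ-datum, on an old level (`b + 1 ≠ k`) and on print's regime, `B♮ K k b Y W c = vecE((1/i) log Ū^b(U_k(triv,W))(Γ…))` as vectors of the Frobenius
  carrier: `B♮` IS print's `B_k` there (for `SU(2)`: `2·½ = 1 < π`).

Nothing of [Balaban1985UV3] asserted beyond the cited tree theorems; no summit / rung / gap claim (YM₃ on T³ is ladder rung R3, not the Clay problem).

References: T. Bałaban, CMP 102 (1985) 255–275 [Balaban1985UV3] ((27)–(29) p.263, (43) p.266); CMP 98 (1985) 17–51 [Balaban1985Averaging] ((21)–(23) p.21, pp.24–25).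
-/

set_option autoImplicit false

noncomputable section

open scoped Matrix.Norms.L2Operator Matrix
open Literature.MathematicalPhysics.QuantumFieldTheory.Balaban1983to89
open Literature.MathematicalPhysics.QuantumFieldTheory.Balaban1983to89.T3ContinuumYM3Torus
open Literature.MathematicalPhysics.QuantumFieldTheory.Balaban1983to89.T3UnitLawDensityEML (ℰp)
open Literature.MathematicalPhysics.QuantumFieldTheory.Balaban1983to89.T3UnitScaleTilt (θBal)
open Literature.MathematicalPhysics.QuantumFieldTheory.Balaban1983to89.T3LevelShift (fieldShift)
open Literature.MathematicalPhysics.QuantumFieldTheory.Balaban1983to89.TreeLengthTorus (tsys)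
open Literature.MathematicalPhysics.QuantumFieldTheory.Balaban1983to89.B10Eq27TorusAxialLog
open Literature.MathematicalPhysics.QuantumFieldTheory.Balaban1983to89.B7Prop1Explicit (l1)
open Literature.MathematicalPhysics.QuantumFieldTheory.Balaban1983to89.B7Prop2Explicit (unitaryUnits)
open Literature.MathematicalPhysics.QuantumFieldTheory.Balaban1983to89.ExpMeanLog (deltaSU)
open Literature.MathematicalPhysics.QuantumFieldTheory.Balaban1983to89.MatrixLog (mlog norm_mlog_le_two_mul)
open Literature.MathematicalPhysics.QuantumFieldTheory.Balaban1983to89.MatrixNorms (ntr norm_ntr_le_opNorm)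
open Literature.MathematicalPhysics.QuantumFieldTheory.Balaban1983to89.B12Membership313IISL (trace_mlog_mem_zmultiples)
open Literature.MathematicalPhysics.QuantumFieldTheory.Balaban1985CMP102
open Literature.MathematicalPhysics.QuantumFieldTheory.Balaban1985CMP102.Setting
open Summit.QuantumFields.Balaban3D.Carriers
open Summit.QuantumFields.Balaban3D.Proofs.Primitives
open Summit.QuantumFields.Balaban3D.Proofs.GroupModelLieC (vecE vecE_apply lieC vecE_mem_lieC_of_mem_span vecE_mem_lieC_of_mem_lie)
open Summit.QuantumFields.YangMills.Theorems
open Summit.QuantumFields.YangMills.Theorems.GlobalSlackCanonicalPolymers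

namespace Summit.QuantumFields.YangMills.Theorems.GlobalSlackKernelLeg

/-! ## §1 The series logarithm of a determinant-one matrix near `1` is trace-free -/

section Trace

variable {N : ℕ}

/-- An integer multiple of `2πi` of modulus `< 2π` is `0`. [folklore] -/
theorem eq_zero_of_mem_zmultiples_of_norm_lt {z : ℂ} (hz : z ∈ AddSubgroup.zmultiples (2 * Real.pi * Complex.I : ℂ)) (h : ‖z‖ < 2 * Real.pi) :
    z = 0 := by
  obtain ⟨k, rfl⟩ := AddSubgroup.mem_zmultiples_iff.mp hz
  have hn : ‖(k : ℤ) • (2 * Real.pi * Complex.I : ℂ)‖ = |(k : ℝ)| * (2 * Real.pi) := by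
    rw [zsmul_eq_mul, norm_mul, Complex.norm_intCast]
    congr 1
    rw [norm_mul, Complex.norm_I, mul_one, Complex.norm_mul, Complex.norm_real, Real.norm_of_nonneg Real.pi_pos.le]
    norm_num
  rw [hn] at h
  have hk : |(k : ℝ)| < 1 := (mul_lt_iff_lt_one_left (by positivity : (0 : ℝ) < 2 * Real.pi)).mp (by linarith)
  have hk0 : k = 0 := by
    have hk' : |k| < 1 := by exact_mod_cast hk
    exact Int.abs_lt_one_iff.mp hk'
  rw [hk0, zero_zsmul]

/-- `|tr X| ≤ N·‖X‖_op` (`MatrixNorms.norm_ntr_le_opNorm` for the normalised trace). [folklore] -/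
theorem norm_trace_le_card_mul_opNorm (X : Matrix (Fin N) (Fin N) ℂ) : ‖X.trace‖ ≤ (N : ℝ) * ‖X‖ := by
  rcases Nat.eq_zero_or_pos N with hN | hN
  · subst hN
    simp [Matrix.trace]
  · haveI : Nonempty (Fin N) := ⟨⟨0, hN⟩⟩
    have h := norm_ntr_le_opNorm X
    have hN0 : (N : ℂ) ≠ 0 := by exact_mod_cast hN.ne'
    have hntr : (N : ℂ) * ntr X = X.trace := by
      rw [ntr, Fintype.card_fin]
      field_simp
    rw [← hntr, norm_mul, Complex.norm_natCast]
    exact mul_le_mul_of_nonneg_left h (Nat.cast_nonneg N)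

/-- **`tr log W = 0`** for `det W = 1`, `‖W − 1‖ ≤ ½` and `N·‖W − 1‖ < π` (then `|tr log W| ≤ 2N‖W − 1‖ < 2π` while `tr log W ∈ 2πiℤ`). [folklore] -/
theorem trace_mlog_eq_zero {W : Matrix (Fin N) (Fin N) ℂ} (hW : ‖W - 1‖ ≤ 1 / 2) (hdet : W.det = 1) (hN : (N : ℝ) * ‖W - 1‖ < Real.pi) :
    (mlog W).trace = 0 := by
  refine eq_zero_of_mem_zmultiples_of_norm_lt (trace_mlog_mem_zmultiples (by linarith) hdet) ?_
  calc ‖(mlog W).trace‖ ≤ (N : ℝ) * ‖mlog W‖ := norm_trace_le_card_mul_opNorm _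
    _ ≤ (N : ℝ) * (2 * ‖W - 1‖) := mul_le_mul_of_nonneg_left (norm_mlog_le_two_mul hW) (Nat.cast_nonneg N)
    _ = 2 * ((N : ℝ) * ‖W - 1‖) := by ring
    _ < 2 * Real.pi := by linarith

end Trace

/-! ## §2 Trace-free matrices vectorise into `𝔤ᶜ = lieC (suGroupModel N)` -/

section LieC

variable {N : ℕ} [NeZero N]

/-- Membership in the Lie algebra of the `SU(N)` model is membership in `𝔰𝔲(N)`. [folklore] -/
theorem mem_lie_suGroupModel_iff (X : Matrix (Fin N) (Fin N) ℂ) : X ∈ (suGroupModel N).lie ↔ Xᴴ = -X ∧ X.trace = 0 := by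
  show X ∈ Literature.Algebra.Lie.CompactKillingForm.su (Fin N) ↔ _
  exact Literature.Algebra.Lie.CompactKillingForm.mem_su_iff

/-- **A TRACE-FREE COMPLEX MATRIX VECTORISES INTO `𝔤ᶜ`**: `X = ½(X − Xᴴ) + (−i)·(½i(X + Xᴴ))` with both `½(X − Xᴴ)` and `½i(X + Xᴴ)` in `𝔰𝔲(N)`, so `vecE X ∈ span_ℂ(vecE 𝔰𝔲(N)) = lieC`.
[folklore] -/
theorem vecE_mem_lieC_of_trace_eq_zero {X : Matrix (Fin N) (Fin N) ℂ} (hX : X.trace = 0) : vecE (suGroupModel N).N X ∈ lieC (suGroupModel N) := by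
  have htr' : Xᴴ.trace = 0 := by rw [Matrix.trace_conjTranspose, hX, star_zero]
  set A : Matrix (Fin N) (Fin N) ℂ := (2 : ℂ)⁻¹ • (X - Xᴴ) with hA
  set T : Matrix (Fin N) (Fin N) ℂ := ((2 : ℂ)⁻¹ * Complex.I) • (X + Xᴴ) with hT
  have hAmem : A ∈ (suGroupModel N).lie := by
    rw [mem_lie_suGroupModel_iff]
    refine ⟨?_, ?_⟩
    · rw [hA, Matrix.conjTranspose_smul, Matrix.conjTranspose_sub, Matrix.conjTranspose_conjTranspose, star_inv₀]
      rw [show star (2 : ℂ) = 2 from star_ofNat 2, ← smul_neg, neg_sub]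
    · rw [hA, Matrix.trace_smul, Matrix.trace_sub, hX, htr', sub_zero, smul_zero]
  have hTmem : T ∈ (suGroupModel N).lie := by
    rw [mem_lie_suGroupModel_iff]
    refine ⟨?_, ?_⟩
    · rw [hT, Matrix.conjTranspose_smul, Matrix.conjTranspose_add, Matrix.conjTranspose_conjTranspose, star_mul', star_inv₀,
        show star (2 : ℂ) = 2 from star_ofNat 2, Complex.star_def, Complex.conj_I, ← neg_smul, add_comm]
      congr 1
      ring
    · rw [hT, Matrix.trace_smul, Matrix.trace_add, hX, htr', add_zero, smul_zero]
  have hdecomp : X = A + (-Complex.I) • T := by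
    have hIT : (-Complex.I) • T = (2 : ℂ)⁻¹ • (X + Xᴴ) := by
      rw [hT, smul_smul, mul_left_comm, neg_mul, Complex.I_mul_I, neg_neg, mul_one]
    rw [hIT, hA, smul_sub, smul_add, sub_add_add_cancel, ← add_smul]
    norm_num
  have hvec : vecE N X = vecE N A + (-Complex.I) • vecE N T := by
    rw [← map_smul, ← map_add, ← hdecomp]
  show vecE N X ∈ lieC (suGroupModel N)
  rw [hvec]
  exact Submodule.add_mem _ (vecE_mem_lieC_of_mem_lie (suGroupModel N) hAmem) (Submodule.smul_mem _ _ (vecE_mem_lieC_of_mem_lie (suGroupModel N) hTmem))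

/-- Hence the `𝔤ᶜ`-projection of a trace-free matrix is the matrix itself. [folklore] -/
theorem coe_proj_vecE_eq_of_trace_eq_zero {X : Matrix (Fin N) (Fin N) ℂ} (hX : X.trace = 0) :
    (((lieC (suGroupModel N)).orthogonalProjectionOnto (vecE (suGroupModel N).N X) : lieC (suGroupModel N)) : EuclideanSpace ℂ (Fin (suGroupModel N).N × Fin (suGroupModel N).N)) =
      vecE (suGroupModel N).N X := by
  have h := (lieC (suGroupModel N)).orthogonalProjectionOnto_mem_subspace_eq_self ⟨vecE (suGroupModel N).N X, vecE_mem_lieC_of_trace_eq_zero hX⟩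
  exact congrArg Subtype.val h

end LieC

/-! ## §3 The (27)-loop variable of an `SU(N)` field is trace-free on print's regime; `B♮` is print's `B_k` there -/

section Loop

variable {P : Params} {j : ℕ} {N : ℕ} [NeZero N]

/-- **`tr B(c) = 0`**: for an `SU(N)`-valued torus configuration with `PlaqSmall α U`, the (27)-loop variable `B(c) = (1/i) log U(Γ_{y,c₋} ∪ c ∪ Γ_{c₊,y})` is trace-free on every bond with
`|c₋ − y|₁·α ≤ ½` and `N·|c₋ − y|₁·α < π` (the holonomy is in `SU(N)`, `det = 1`, within `|c₋ − y|₁·α` of `1`). [cite: Balaban1985UV3, (27)-(28) p.263] -/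
theorem trace_B27T_eq_zero (U : GaugeField P j (Matrix.specialUnitaryGroup (Fin N) ℂ)) {α : ℝ} (hα : 0 ≤ α) (hU : PlaqSmall α U) (y : Site P j) (c : PBond P j)
    (hsmall : (l1 (rel y c.src) : ℝ) * α ≤ 1 / 2) (hπ : (N : ℝ) * ((l1 (rel y c.src) : ℝ) * α) < Real.pi) :
    (B27T (unitsField (toUField U)) y c).trace = 0 := by
  letI : CStarAlgebra (Matrix (Fin N) (Fin N) ℂ) := B10Eq29TubeLine.cstarAlgebraMatrix N
  have hU1 : ∀ b, unitsField (toUField U) b ∈ unitaryUnits (Matrix (Fin N) (Fin N) ℂ) := unitsField_mem_unitaryUnits _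
  have h13 := h13_unitsField (lo := fun _ => -(P.sitesPerDir j : ℤ)) (hi := fun _ => (P.sitesPerDir j : ℤ)) (toUField U) y (α := α)
    (fun z κ μ hκμ _ => by rw [dist1_plaqHol_toUField]; exact (hU _).le)
  have hhol := norm_holT_contourT_sub_one_le (fun i => by omega) (unitsField (toUField U)) (U1_of_unitaryUnits hU1) y h13 hα
    (inBox_window_zero P j) c (inBox_window_rel y c.src) (inBox_window_rel_add_e y c.src c.dir)
  have hmat : ((holT (unitsField (toUField U)) y (contourT y c) : (Matrix (Fin N) (Fin N) ℂ)ˣ) : Matrix (Fin N) (Fin N) ℂ) =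
      ((holT U y (contourT y c) : Matrix.specialUnitaryGroup (Fin N) ℂ) : Matrix (Fin N) (Fin N) ℂ) := by
    rw [val_holT_unitsField, holT_toUField]; rfl
  have hdet : (((holT (unitsField (toUField U)) y (contourT y c) : (Matrix (Fin N) (Fin N) ℂ)ˣ) : Matrix (Fin N) (Fin N) ℂ)).det = 1 := by
    rw [hmat]
    exact (Matrix.mem_specialUnitaryGroup_iff.mp (holT U y (contourT y c)).2).2
  rw [B27T_eq, Matrix.trace_smul, trace_mlog_eq_zero (hhol.trans hsmall) hdet (lt_of_le_of_lt (mul_le_mul_of_nonneg_left hhol (Nat.cast_nonneg N)) hπ),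
    smul_zero]

end Loop

section Natural

variable {F : T3Family} {𝔠 : AlphaConsts F.L (suGroupModel 2).N} {γ : ℝ} {hγ : 0 < γ} {hγ1 : γ ≤ (min 𝔠.gamma0 1) ^ 2}

open Classical in
/-- **ON AN OLD LEVEL AND ON PRINT'S REGIME, `B♮` IS PRINT'S LOOP VARIABLE** (as vectors of the Frobenius carrier): at the χ-datum, under the minimiser rows of the package and the window
letters at height `n < K`, for `j + 1 < K − n`, an anchor `y(Y)` of `Y = blockSet K (1+j) y′` and a bond with `|c₋ − y(Y)|₁·2B₃θ_{p₁}(n)(L^{K−n−j})⁻² ≤ ½`: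
`B♮ K (K−n) j Y (V↑) c = vecE((1/i) log Ū^j(U_{K−n}(triv,V↑))(Γ_{y,c₋} ∪ c ∪ Γ_{c₊,y}))` — the `lieC`-projection is the identity there (`2·½ = 1 < π`).
[cite: Balaban1985UV3, (27)-(29) p.263, (43) p.266] -/
theorem coe_natural_eq_vecE_B27T (p : ∀ K, AlphaInputsT3AC.PkgAtV3Chi F 𝔠 γ hγ hγ1 K) {p₁ : ℝ} {K n : ℕ} (hn : n < K)
    (hθ : θBal F.L γ 𝔠.b₀ p₁ n ≤ (p K).a₁ ∧ 𝔠.B₃ * θBal F.L γ 𝔠.b₀ p₁ n ≤ (p K).a₀ ∧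
      (143 * ((((3 + 4 : ℕ) : ℝ)) ^ 2 / 4) ^ 2) * (𝔠.B₃ * θBal F.L γ 𝔠.b₀ p₁ n) ≤ 1 / 3 ∧
      2 * (𝔠.B₃ * θBal F.L γ 𝔠.b₀ p₁ n) ≤ 2 * deltaSU (Fin 2) / (((3 + 4) * F.L : ℕ) : ℝ) ^ 2)
    {j : ℕ} (hj : j + 1 < K - n) (y' : Site (F.P K) (1 + j)) (V : GaugeField (F.P n) 0 (Matrix.specialUnitaryGroup (Fin 2) ℂ))
    (hV : PlaqSmall (θBal F.L γ 𝔠.b₀ p₁ n) V) (c : PBond (F.P K) j)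
    (hreg : (l1 (rel (anchors_nonempty (F := F) K j (blockSet K (1 + j) y')).choose c.src) : ℝ) *
        (2 * (𝔠.B₃ * θBal F.L γ 𝔠.b₀ p₁ n) * (((F.L : ℝ) ^ (K - n - j))⁻¹) ^ 2) ≤ 1 / 2) :
    (((fun K k b Y W c =>
        if h : b + 1 = k then birthCfgAt (fun K => (p K).toCore) K b Y (h ▸ W) c
        else if (l1 (rel (anchors_nonempty (F := F) K b Y).choose c.src) : ℝ) *
            (2 * (𝔠.B₃ * θBal F.L γ 𝔠.b₀ p₁ (K - k)) * (((F.L : ℝ) ^ (k - b))⁻¹) ^ 2) ≤ 1 / 2 then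
          (lieC (suGroupModel 2)).orthogonalProjectionOnto
            (vecE (suGroupModel 2).N
              (B27T (unitsField (toUField (Averaging.iter (fun i => BlockAveraging.blockAvg (P := F.P K) (j := i) ℰp) b
                ((p K).UkH k (Hist.triv (F.P K) k) W)))) (anchors_nonempty (F := F) K b Y).choose c))
        else 0) K (K - n) j (blockSet K (1 + j) y')
        (fieldShift (F.sitesPerDir_eq (m := F.m) (K := K) (j := K - n) (m' := F.m) (K' := n) (j' := 0) (by omega)) V) c :
          lieC (suGroupModel 2)) : EuclideanSpace ℂ (Fin (suGroupModel 2).N × Fin (suGroupModel 2).N)) =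
      vecE (suGroupModel 2).N
        (B27T (unitsField (toUField (Averaging.iter (fun i => BlockAveraging.blockAvg (P := F.P K) (j := i) ℰp) j
          ((p K).UkH (K - n) (Hist.triv (F.P K) (K - n))
            (fieldShift (F.sitesPerDir_eq (m := F.m) (K := K) (j := K - n) (m' := F.m) (K' := n) (j' := 0) (by omega)) V)))))
          (anchors_nonempty (F := F) K j (blockSet K (1 + j) y')).choose c) := by
  haveI : NeZero (suGroupModel 2).N := inferInstanceAs (NeZero 2)
  have hKn : K - (K - n) = n := by omega
  have hjne : ¬ (j + 1 = K - n) := by omega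
  obtain ⟨h1, h2, h3, h4⟩ := hθ
  have hγ1' : γ ≤ 1 := hγ1.trans (sq_min_one_le _ 𝔠.gamma0_pos)
  have hθpos : 0 < θBal F.L γ 𝔠.b₀ p₁ n := T3MinimiserStabilityReduction.θBal_pos F.hL.2.le hγ hγ1' 𝔠.b₀_pos p₁ n
  have he : 0 < 𝔠.B₃ * θBal F.L γ 𝔠.b₀ p₁ n := mul_pos 𝔠.B₃_pos hθpos
  dsimp only
  rw [dif_neg hjne, hKn, if_pos hreg]
  refine coe_proj_vecE_eq_of_trace_eq_zero (N := 2) (trace_B27T_eq_zero _ (by positivity) ?_ _ c hreg ?_)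
  · -- the averaged field's plaquettes: [B7] Prop 2 on r1's plaquette clause, in the level factor `(L^{K−n−j})⁻²`
    have hplaq := plaqSmall_minimiser_of_rows_window (p K).minRows hn hθpos h1 h2 V hV
    have h52 : PlaqSmall ((𝔠.B₃ * θBal F.L γ 𝔠.b₀ p₁ n) * ((((F.P K).L : ℝ) ^ (K - n))⁻¹) ^ 2)
        ((p K).UkH (K - n) (Hist.triv (F.P K) (K - n))
          (fieldShift (F.sitesPerDir_eq (m := F.m) (K := K) (j := K - n) (m' := F.m) (K' := n) (j' := 0) (by omega)) V)) := by
      intro q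
      convert hplaq q using 2
      rw [T3RegularMinimiser.regThreshold, ← inv_pow, ← pow_mul, mul_comm 2]
      rfl
    have hlev := BlockAveragingEMLProp2.plaqSmall_iter_blockAvg_eml_level (P := F.P K) (n := Fin 2) (K - n) he h3 h4 h52 (j := j) (by omega)
    rw [show ((F.P K).L : ℝ) = F.L from rfl, pow_mul_inv_pow_eq F (show j ≤ K - n by omega)] at hlev
    exact hlev
  · calc ((2 : ℕ) : ℝ) * ((l1 (rel (anchors_nonempty (F := F) K j (blockSet K (1 + j) y')).choose c.src) : ℝ) *
          (2 * (𝔠.B₃ * θBal F.L γ 𝔠.b₀ p₁ n) * (((F.L : ℝ) ^ (K - n - j))⁻¹) ^ 2)) ≤ 2 * (1 / 2) := by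
          rw [show ((2 : ℕ) : ℝ) = 2 by norm_num]; exact mul_le_mul_of_nonneg_left hreg (by norm_num)
      _ = 1 := by norm_num
      _ < Real.pi := by have := Real.pi_gt_three; linarith

end Natural

end Summit.QuantumFields.YangMills.Theorems.GlobalSlackKernelLeg

end
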